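import Mathlib.Analysis.Convex.Hull
import Mathlib.Analysis.Convex.Segment
import Literature.Probability.RandomPlanarGeometry.CardyFunction
import Literature.Probability.RandomPlanarGeometry.ConformalRectangle
import Literature.Probability.Percolation.CritPercWave0
import HarnessLib

-- provenance: harness21/H21/H21/Statements/CritPerc/CardyFunction.lean @ 7b57685 (interim HEAD d8f2665); M5 mechanical rewrite
/-!
# Cardy's function: characteristic properties and Carleson's form (family `crit-perc`)

This statements file records **crit-perc.S17** (definition-role statement):

* the characteristic properties of Cardy's function
  `F(η) = (3 Γ(2/3) / Γ(1/3)²) · η^{1/3} · ₂F₁(1/3, 2/3; 4/3; η)`: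
  `F(0) = 0`, `F(1) = 1`, `F` is continuous and strictly increasing on `[0,1]`, and
  `F(1 - η) = 1 - F(η)` (`cardyFunction_props`, assembled from the prelude lemmas of
  `Literature.Prelude.Stoch.CardyFunction`);
* **Carleson's observation**: transported to an equilateral triangle `abc` with the fourth marked
  point `d` on the side `ca`, Cardy's crossing probability from the side `ab` to the arc `cd` is
  the linear function `|d - c| / |a - c|`
  (`cardyFunction_crossRatio_eq_of_equilateral`, sorried with citation);
* the migration sanity lemma `cardyFunction_eq_prelude`: the wave-0 definition
  `Literature.Probability.Percolation.cardyFunction` and the prelude definition `Literature.Probability.RandomPlanarGeometry.cardyFunction` agree by `rfl`.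

## Design notes

* This file imports both `Literature.Prelude.Stoch.CardyFunction` and `Literature.Statements.CritPerc.Wave0`;
  inside `namespace Literature.CritPerc` the bare name `cardyFunction` is ambiguous, so
  `Literature.Probability.RandomPlanarGeometry.cardyFunction` is written fully qualified throughout.
* Carleson's form is stated for ANY conformal rectangle `R` whose carrier is the open equilateral
  triangle `interior (convexHull ℝ {a, b, c})` with marked points `a, b, c, d` (in this cyclic
  order, which the structure `MarkedDomain` enforces) and `d` strictly inside the side `ca`, and for
  every uniformizing datum `(φ, x)` of `R` (`MarkedDomain.IsUniformizing`; non-vacuous by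
  `MarkedDomain.exists_isUniformizing`, well defined by
  `ConformalRectangle.crossRatio_eq_of_isUniformizing`). With Cardy's cross-ratio
  `η = (x₀ - x₁)(x₂ - x₃) / ((x₀ - x₂)(x₁ - x₃))` (`Literature.Probability.RandomPlanarGeometry.crossRatio`), `F(η)` is the crossing
  probability between the arcs `(x₀x₁) = (ab)` and `(x₂x₃) = (cd)`; as `d → c` both sides tend
  to `0`, as `d → a` both tend to `1`.
* Mathlib anchors USED: `convexHull`, `segment`, `interior`, `ContinuousOn`, `StrictMonoOn`.
  Mathlib has no Cardy function / cross-ratio (searched `cardy`, `crossRatio`); those are H21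
  prelude notions.

## References

* J. Cardy, *Critical percolation in finite geometries*, J. Phys. A 25 (1992) L201–L206,
  eqs. (8), (11).
* L. Carleson, unpublished; recorded in S. Smirnov, *Critical percolation in the plane: conformal
  invariance, Cardy's formula, scaling limits*, C. R. Acad. Sci. Paris Sér. I Math. 333 (2001),
  239–244.
* W. Werner, *Lectures on two-dimensional critical percolation*, IAS/Park City (2007), §3.
* summits/crit-perc-z2/SUMMIT.md.
-/

open Set
open UpperHalfPlane (upperHalfPlaneSet)

noncomputable section

namespace Literature.Probability.RandomPlanarGeometry

/-- Migration sanity lemma: the wave-0 definition `Literature.Probability.Percolation.cardyFunction`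
(`H21/Statements/CritPerc/Wave0.lean`) and the prelude definition `Literature.Probability.RandomPlanarGeometry.cardyFunction`
(`H21/Prelude/Stoch/CardyFunction.lean`) have character-identical bodies, hence agree by `rfl`.
NOTE FOR SUPERVISOR: Wave0 should be re-pointed to `import Literature.Prelude.Stoch.CardyFunction` and
its copy of `cardyFunction` deleted; this lemma then becomes obsolete (Cardy, J. Phys. A 25 (1992)
L201, eq. (11)). [folklore] -/
theorem cardyFunction_eq_prelude : Literature.Probability.Percolation.cardyFunction = Literature.Probability.RandomPlanarGeometry.cardyFunction := rfl

/-- **crit-perc.S17** (Cardy's function and its properties; Cardy, J. Phys. A 25 (1992) L201,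
eqs. (8), (11); Werner 2007, §3; summits/crit-perc-z2/SUMMIT.md).
Cardy's function `F(η) = (3 Γ(2/3) / Γ(1/3)²) · η^{1/3} · ₂F₁(1/3, 2/3; 4/3; η)` satisfies
`F(0) = 0`, `F(1) = 1`, is continuous and strictly increasing on `[0,1]`, and has the duality
symmetry `F(1 - η) = 1 - F(η)` for `η ∈ [0,1]`. Assembled from the prelude lemmas
`cardyFunction_zero`, `cardyFunction_one`, `continuousOn_cardyFunction`,
`strictMonoOn_cardyFunction`, `cardyFunction_one_sub` (Gauss summation and the hypergeometric
ODE, sorried there). [cite: Werner2007, §3] -/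
def cardyFunction_props : Prop :=
  Literature.Probability.RandomPlanarGeometry.cardyFunction 0 = 0 ∧ Literature.Probability.RandomPlanarGeometry.cardyFunction 1 = 1 ∧
      ContinuousOn Literature.Probability.RandomPlanarGeometry.cardyFunction (Icc 0 1) ∧ StrictMonoOn Literature.Probability.RandomPlanarGeometry.cardyFunction (Icc 0 1) ∧
        ∀ η ∈ Icc (0 : ℝ) 1, Literature.Probability.RandomPlanarGeometry.cardyFunction (1 - η) = 1 - Literature.Probability.RandomPlanarGeometry.cardyFunction η

/- interim proof relied on results that are now named facts (D-0014); demoted to a fact by the M5 import, proof preserved: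
:=
  ⟨Literature.cardyFunction_zero, Literature.cardyFunction_one, Literature.continuousOn_cardyFunction,
    Literature.strictMonoOn_cardyFunction, fun _ h => Literature.cardyFunction_one_sub h⟩
-/

/-- **crit-perc.S17** (Carleson's form of Cardy's formula; L. Carleson, recorded in Smirnov,
C. R. Acad. Sci. Paris 333 (2001), 239–244; Werner 2007, §3; summits/crit-perc-z2/SUMMIT.md).
Let `abc` be a (non-degenerate) equilateral triangle and let `R` be any conformal rectangle whose
carrier is the open triangle `interior (convexHull ℝ {a, b, c})`, with marked points
`a, b, c, d` where `d ≠ c, a` lies on the side `ca`. Then for every uniformizing datum `(φ, x)` of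
`R` (`φ : ℍₒ → R` conformal with boundary values `a, b, c, d` at the real points
`x₀, x₁, x₂, x₃`), Cardy's function of the cross-ratio is the linear function
`F(η) = |d - c| / |a - c|`: transported to the equilateral triangle, the conformal map
`ℍₒ → abc` given by the Schwarz–Christoffel integral `∫ (t(1-t))^{-2/3} dt` (Cardy's eq. (8))
sends the crossing probability to an affine function of the fourth vertex. [cite: Werner2007, §3] -/
def cardyFunction_crossRatio_eq_of_equilateral : Prop :=
  ∀ (R : ConformalRectangle) (a b c d : ℂ) (habc : dist a b = dist b c ∧ dist b c = dist c a ∧ a ≠ b) (hR : R.carrier = interior (convexHull ℝ {a, b, c})) (hpt : R.pt 0 = a ∧ R.pt 1 = b ∧ R.pt 2 = c ∧ R.pt 3 = d) (hd : d ∈ segment ℝ c a) (hdc : d ≠ c) (hda : d ≠ a) {φ : ConformalEquiv upperHalfPlaneSet R.carrier} {x : Fin 4 → ℝ} (hφ : R.IsUniformizing φ x),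
    Literature.Probability.RandomPlanarGeometry.cardyFunction (crossRatio x) = ‖d - c‖ / ‖a - c‖

end Literature.Probability.RandomPlanarGeometry
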